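import Summits.BirchSwinnertonDyer.BirchSwinnertonDyer.Theorems.ManinLocalTwoThreeShimuraIndexMuThreeLine
import Summits.BirchSwinnertonDyer.BirchSwinnertonDyer.Theorems.ManinLocalTwoThreeThreeBlindInvariance
import Literature.NumberTheory.EllipticCurves.WeilPairingProofs
import Literature.NumberTheory.EllipticCurves.OpenImageMazurProofs
import Literature.NumberTheory.EllipticCurves.ThreeDivisionFieldSwanProofs
import HarnessLib

/-!
# The `μ₃`-configuration IS `HasShortMuThree`: `3 ∣ [Λ₀(f) : Λ₁(f)]` ⟹ a rational `3`-torsion point or `μ₃ ⊂ W`;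
# E-es-67 ⟸ E-es-67♯ and E-an-128 ⟸ its `μ₃`-form, BY NAME — part 2 of 2 (part 1: `…ShimuraIndexMuThreeLine.lean`, the Weil-pairing
# coordinate theorem `exists_isRoot_Ψ₃_and_sq_eq_neg_three_mul_sq_of_trivialQuotientLine`)

Summit `BirchSwinnertonDyer`, route `ManinLocalTwoThree` (cell bsd-f2-manin), crux C3 `ManinPrimeToThreeAtNine`
(stmt-BirchSwinnertonDyer-22968; also C2 stmt-BirchSwinnertonDyer-22967).  Prover seat bsd-line-manin23-p1 (C2/C3 LEAD), gen 9;
sequel to `ManinLocalTwoThreeShimuraIndexDichotomy.lean`.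

* `exists_isRoot_Ψ₃_and_sq_eq_neg_three_mul_sq_of_trivialQuotientLine` — for an elliptic `W/ℚ` and a `Γ_ℚ`-stable `3`-line
  `H ≤ W[3]` with TRIVIAL quotient character (`σT − T ∈ H`): `H = {O, ±P}` with `x(P) = x₀ ∈ ℚ`, `Ψ₃(x₀) = 0` and
  `(2y + a₁x₀ + a₃)² = 4x₀³ + b₂x₀² + 2b₄x₀ + b₆ = −3t₀²`, `t₀ ∈ ℚˣ` — i.e. `H ≅ μ₃`: by the WEIL PAIRING (tree
  `exists_weilPairing_holds`: bilinear, alternating, non-degenerate, Galois-equivariant) `ζ = e₃(Q, P)` is a primitive cube root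
  of unity on which every `σ` acts by the same sign as on `P` (`det ρ̄ = ω` on the line), so `(2y + a₁x + a₃)·(2ζ + 1)` is
  `Γ_ℚ`-fixed, hence rational, and `(2ζ + 1)² = −3`.
* `hasShortMuThree_of_trivialQuotientLine` — transported to the short model `E_{W,c}` (`X₀ = c²(x₀ + b₂/12)`,
  `Ψ₃^{E_{W,c}}(X₀) = c⁸Ψ₃(x₀)`, `X₀³ + a₄X₀ + a₆ = c⁶(4x₀³ + b₂x₀² + 2b₄x₀ + b₆)/4`): `HasShortMuThree W c`.
* `exists_isShortThreeTorsion_of_addOrderOf_eq_three` — a rational point of order `3` on `W` gives `IsShortThreeTorsion W c X₀ Y₀`.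
* **`exists_isShortThreeTorsion_or_hasShortMuThree_of_not_shimuraIndexPrimeTo_three`** — `3 ∣ [Λ₀(f) : Λ₁(f)]` ⟹ a rational
  `3`-torsion point on `E_{W,c}` OR `μ₃ ⊂ W` (`HasShortMuThree W c`), every level, every `c ≠ 0`, no optimality.
* **`plusIndexPrimeToThreeOfNoRationalThreeTorsion_of_sharp`** — es's E-es-67 `PlusIndexPrimeToThreeOfNoRationalThreeTorsion` from
  E-es-67♯ `PlusIndexPrimeToThreeOfMuThreeNoRationalThreeTorsion` ALONE (the leaf's `…_of_halves` needed E-es-67♮ too);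
  `plusIndexPrimeTo_three_of_no_shortThreeTorsion_of_not_hasShortMuThree` — the unconditional part.
* **`shimuraThreeForcesRationalThreeTorsion_of_muThree`** — an's E-an-128 `ShimuraThreeForcesRationalThreeTorsion` from the single
  residual law «lattice-optimal `W` with `μ₃ ⊂ W` and no rational `3`-torsion has `3 ∤ [Λ₀ : Λ₁]`» (stated inline).

HONEST FRAMING: unconditional tree theorems except the two displayed reductions, whose hypotheses (E-es-67♯, the `μ₃`-residual) are
OPEN cell laws.  No crux stub is narrowed; C2, C3, Manin's conjecture and BSD are NOT proved by this file.  No definitions, no sorry.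

References: J. H. Silverman, *AEC* III.8.1 (Weil pairing), Ex. 3.7 [SilvermanAEC2009]; Cornell–Silverman–Stevens II §§7–8
(`det ρ̄ = χ`) [SilvermanCSS1997]; N. M. Katz, Invent. Math. 62 (1981) Thm. 2 [Katz1980]; K. Ribet [Ribet1988Shimura].
-/

set_option autoImplicit false
set_option linter.dupNamespace false

noncomputable section

open scoped Classical MatrixGroups ModularForm

open CongruenceSubgroup WeierstrassCurve Field Polynomial Literature.NumberTheory.EllipticCurves
  Literature.NumberTheory.EllipticCurves.ModularForms
open Summit.BirchSwinnertonDyer.Rank1Residual.ManinAdditive.KatoCurve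
  Summit.BirchSwinnertonDyer.Rank1Residual.ManinAdditive.CuspidalKummer
  Summit.BirchSwinnertonDyer.Rank1Residual.ManinAdditive.CuspidalKummerThree

namespace Summit.BirchSwinnertonDyer.BirchSwinnertonDyer.Theorems.ManinLocalTwoThree

/-! ### §2. Transport to the short model `E_{W,c}` -/

/-- `Ψ₃` of `W` as an explicit quartic. [cite: SilvermanAEC2009, Exercise 3.7] -/
theorem isRoot_Ψ₃_iff (W : WeierstrassCurve ℚ) (x₀ : ℚ) :
    W.Ψ₃.IsRoot x₀ ↔ 3 * x₀ ^ 4 + W.b₂ * x₀ ^ 3 + 3 * W.b₄ * x₀ ^ 2 + 3 * W.b₆ * x₀ + W.b₈ = 0 := by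
  rw [Polynomial.IsRoot, WeierstrassCurve.Ψ₃]
  simp only [Polynomial.eval_add, Polynomial.eval_mul, Polynomial.eval_pow, Polynomial.eval_C, Polynomial.eval_X,
    Polynomial.eval_ofNat]

/-- The cubic of the short model at `X₀ = c²(x + b₂/12)`: `X₀³ + a₄X₀ + a₆ = (c⁶/4)·(4x³ + b₂x² + 2b₄x + b₆)`.
[cite: SilvermanAEC2009, III.1 (b₂, b₄, b₆, c₄, c₆)] -/
theorem shortModel_cubic_eq (W : WeierstrassCurve ℚ) (c : ℤ) (x : ℚ) :
    ((c : ℚ) ^ 2 * (x + W.b₂ / 12)) ^ 3 + (shortModel W c).a₄ * ((c : ℚ) ^ 2 * (x + W.b₂ / 12)) +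
        (shortModel W c).a₆ =
      (c : ℚ) ^ 6 / 4 * (4 * x ^ 3 + W.b₂ * x ^ 2 + 2 * W.b₄ * x + W.b₆) := by
  simp only [shortModel, WeierstrassCurve.c₄, WeierstrassCurve.c₆]
  ring

/-- The `Ψ₃`-quartic of the short model at `X₀ = c²(x + b₂/12)` is `c⁸` times that of `W` at `x`.
[cite: SilvermanAEC2009, Exercise 3.7] -/
theorem shortModel_Ψ₃_quartic_eq (W : WeierstrassCurve ℚ) (c : ℤ) (x : ℚ) :
    3 * ((c : ℚ) ^ 2 * (x + W.b₂ / 12)) ^ 4 + 6 * (shortModel W c).a₄ * ((c : ℚ) ^ 2 * (x + W.b₂ / 12)) ^ 2 +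
        12 * (shortModel W c).a₆ * ((c : ℚ) ^ 2 * (x + W.b₂ / 12)) - (shortModel W c).a₄ ^ 2 =
      (c : ℚ) ^ 8 * (3 * x ^ 4 + W.b₂ * x ^ 3 + 3 * W.b₄ * x ^ 2 + 3 * W.b₆ * x + W.b₈) := by
  simp only [shortModel, WeierstrassCurve.c₄, WeierstrassCurve.c₆, WeierstrassCurve.b₂, WeierstrassCurve.b₄,
    WeierstrassCurve.b₆, WeierstrassCurve.b₈]
  ring

/-- **`μ₃`-configuration ⟹ `HasShortMuThree W c`** (`c ≠ 0`): on `E_{W,c}` the point `X₀ = c²(x₀ + b₂/12)` is a root of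
`Ψ₃` (`Ψ₃^{E_{W,c}}(X₀) = c⁸ Ψ₃(x₀)`) and `X₀³ + a₄X₀ + a₆ = c⁶(4x₀³ + b₂x₀² + 2b₄x₀ + b₆)/4 = −3 (c³t₀/2)²`.
[cite: SilvermanAEC2009, III.1 (c₄, c₆ and the short model) and Exercise 3.7] -/
theorem hasShortMuThree_of_trivialQuotientLine (W : WeierstrassCurve ℚ) [W.IsElliptic] {c : ℤ} (hc : c ≠ 0)
    {H : AddSubgroup (W.geomTorsion 3)} (hH : Nat.card H = 3)
    (hst : ∀ σ : absoluteGaloisGroup ℚ, ∀ a ∈ H, σ • a ∈ H)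
    (htriv : ∀ (σ : absoluteGaloisGroup ℚ) (T : W.geomTorsion 3), σ • T - T ∈ H) :
    HasShortMuThree W c := by
  obtain ⟨x₀, t₀, hΨ, ht₀, hcub⟩ :=
    exists_isRoot_Ψ₃_and_sq_eq_neg_three_mul_sq_of_trivialQuotientLine W hH hst htriv
  have hcQ : (c : ℚ) ≠ 0 := Int.cast_ne_zero.mpr hc
  rw [isRoot_Ψ₃_iff] at hΨ
  refine ⟨(c : ℚ) ^ 2 * (x₀ + W.b₂ / 12), (c : ℚ) ^ 3 * t₀ / 2, ?_, ?_, ?_⟩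
  · rw [isRoot_Ψ₃_shortModel_iff, shortModel_Ψ₃_quartic_eq, hΨ, mul_zero]
  · exact div_ne_zero (mul_ne_zero (pow_ne_zero 3 hcQ) ht₀) two_ne_zero
  · rw [shortModel_cubic_eq, hcub]; ring

/-- **A rational point of order `3` on `W` gives a rational point of order `3` on the short model `E_{W,c}`**
(`(x, y) ↦ (c²(x + b₂/12), c³(2y + a₁x + a₃)/2)`; `Ψ₃(x) = 0` by the tree's
`eval_divisionPolynomial_three_eq_zero_of_three_smul_eq_zero`). [cite: SilvermanAEC2009, Exercise 3.7 and III.1] -/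
theorem exists_isShortThreeTorsion_of_addOrderOf_eq_three (W : WeierstrassCurve ℚ) [W.IsElliptic] {c : ℤ} (hc : c ≠ 0)
    {Q : W.toAffine.Point} (hQ : addOrderOf Q = 3) : ∃ X₀ Y₀ : ℚ, IsShortThreeTorsion W c X₀ Y₀ := by
  have hcQ : (c : ℚ) ≠ 0 := Int.cast_ne_zero.mpr hc
  have hQ0 : Q ≠ 0 := by
    intro h; rw [h, addOrderOf_zero] at hQ; norm_num at hQ
  rcases Q with _ | ⟨x, y, hxy⟩
  · exact (hQ0 rfl).elim
  have h3 : ((3 : ℕ) : ℤ) • (Affine.Point.some x y hxy : W.toAffine.Point) = 0 := by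
    rw [natCast_zsmul, ← hQ]; exact addOrderOf_nsmul_eq_zero _
  -- (`convert`: the tree lemma is stated for a general field, with the classical `DecidableEq` instance)
  have hΨe : W.Ψ₃.eval x = 0 := by
    refine eval_divisionPolynomial_three_eq_zero_of_three_smul_eq_zero (V := W) (x := x) (y := y) (h := hxy) ?_
    convert h3 using 10
  have hΨ : W.Ψ₃.IsRoot x := hΨe
  rw [isRoot_Ψ₃_iff] at hΨ
  have heq : y ^ 2 + W.a₁ * x * y + W.a₃ * y = x ^ 3 + W.a₂ * x ^ 2 + W.a₄ * x + W.a₆ := by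
    have h := (Affine.equation_iff_nonsingular.mpr hxy)
    rwa [Affine.equation_iff] at h
  have hwsq : (2 * y + W.a₁ * x + W.a₃) ^ 2 = 4 * x ^ 3 + W.b₂ * x ^ 2 + 2 * W.b₄ * x + W.b₆ := by
    simp only [WeierstrassCurve.b₂, WeierstrassCurve.b₄, WeierstrassCurve.b₆]
    linear_combination (4 : ℚ) * heq
  have hΔ : (shortModel W c).toAffine.Δ ≠ 0 := by
    change (shortModel W c).Δ ≠ 0
    rw [shortModel_Δ]; exact mul_ne_zero (pow_ne_zero _ hcQ) W.isUnit_Δ.ne_zero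
  refine ⟨(c : ℚ) ^ 2 * (x + W.b₂ / 12), (c : ℚ) ^ 3 * (2 * y + W.a₁ * x + W.a₃) / 2, ?_, ?_⟩
  · rw [← (shortModel W c).toAffine.equation_iff_nonsingular_of_Δ_ne_zero hΔ, Affine.equation_iff]
    have h1 : (shortModel W c).toAffine.a₁ = 0 := rfl
    have h2 : (shortModel W c).toAffine.a₂ = 0 := rfl
    have h3' : (shortModel W c).toAffine.a₃ = 0 := rfl
    have h4 : (shortModel W c).toAffine.a₄ = (shortModel W c).a₄ := rfl
    have h6 : (shortModel W c).toAffine.a₆ = (shortModel W c).a₆ := rfl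
    rw [h1, h2, h3', h4, h6]
    have hc3 := shortModel_cubic_eq W c x
    linear_combination (c : ℚ) ^ 6 / 4 * hwsq - hc3
  · rw [isRoot_Ψ₃_shortModel_iff, shortModel_Ψ₃_quartic_eq, hΨ, mul_zero]

/-! ### §3. `3 ∣ [Λ₀ : Λ₁]` ⟹ rational `3`-torsion or `μ₃ ⊂ W`; E-es-67 ⟸ E-es-67♯; E-an-128 ⟸ its `μ₃`-form -/

variable (W : WeierstrassCurve ℚ) [W.IsElliptic] [W.IsGloballyMinimal] {N : ℕ} [NeZero N]

/-- **`3 ∣ [Λ₀(f) : Λ₁(f)]` ⟹ a rational point of order `3` on `E_{W,c}`, or `μ₃ ⊂ W`** (`HasShortMuThree W c`), for the newform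
`f` of a globally minimal elliptic `W/ℚ`, every level, every `c ≠ 0`, no optimality.  (Dichotomy
`exists_addOrderOf_eq_three_or_trivialQuotientLine_of_not_shimuraIndexPrimeTo_three` + §§1–2.)
[cite: Katz1980, Thm. 2 (m = ℓ)] [cite: SilvermanAEC2009, Prop. III.8.1] [cite: Ribet1988Shimura, Thm. 1 and §3] -/
theorem exists_isShortThreeTorsion_or_hasShortMuThree_of_not_shimuraIndexPrimeTo_three
    {f : CuspForm (Gamma0 N) 2} (hf : IsNewformOf W f) (hS : ¬ ShimuraIndexPrimeTo 3 f) {c : ℤ} (hc : c ≠ 0) :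
    (∃ X₀ Y₀ : ℚ, IsShortThreeTorsion W c X₀ Y₀) ∨ HasShortMuThree W c := by
  rcases exists_addOrderOf_eq_three_or_trivialQuotientLine_of_not_shimuraIndexPrimeTo_three W hf hS with
    ⟨Q, hQ⟩ | ⟨H, hH, hst, htriv⟩
  · exact Or.inl (exists_isShortThreeTorsion_of_addOrderOf_eq_three W hc hQ)
  · exact Or.inr (hasShortMuThree_of_trivialQuotientLine W hc hH hst htriv)

/-- **The unconditional part of E-es-67 (every level, no optimality):** no rational `3`-torsion on `E_{W,c}` and `μ₃ ⊄ W`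
(`¬ HasShortMuThree W c`) ⟹ `PlusIndexPrimeTo 3 f`. [cite: Katz1980, Thm. 2 (m = ℓ)] [cite: LingOesterle1991, §1] -/
theorem plusIndexPrimeTo_three_of_no_shortThreeTorsion_of_not_hasShortMuThree
    {f : CuspForm (Gamma0 N) 2} (hf : IsNewformOf W f) {c : ℤ} (hc : c ≠ 0)
    (hT : ∀ X₀ Y₀ : ℚ, ¬ IsShortThreeTorsion W c X₀ Y₀) (hμ : ¬ HasShortMuThree W c) : PlusIndexPrimeTo 3 f := by
  refine plusIndexPrimeTo_of_shimuraIndexPrimeTo Nat.prime_three f ?_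
  by_contra hS
  rcases exists_isShortThreeTorsion_or_hasShortMuThree_of_not_shimuraIndexPrimeTo_three W hf hS hc with
    ⟨X₀, Y₀, h⟩ | h
  · exact hT X₀ Y₀ h
  · exact hμ h

/-- The Shimura-index form. [cite: Katz1980, Thm. 2 (m = ℓ)] [cite: Ribet1988Shimura, Thm. 1 and §3] -/
theorem shimuraIndexPrimeTo_three_of_no_shortThreeTorsion_of_not_hasShortMuThree
    {f : CuspForm (Gamma0 N) 2} (hf : IsNewformOf W f) {c : ℤ} (hc : c ≠ 0)
    (hT : ∀ X₀ Y₀ : ℚ, ¬ IsShortThreeTorsion W c X₀ Y₀) (hμ : ¬ HasShortMuThree W c) : ShimuraIndexPrimeTo 3 f := by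
  by_contra hS
  rcases exists_isShortThreeTorsion_or_hasShortMuThree_of_not_shimuraIndexPrimeTo_three W hf hS hc with
    ⟨X₀, Y₀, h⟩ | h
  · exact hT X₀ Y₀ h
  · exact hμ h

omit W [W.IsElliptic] [W.IsGloballyMinimal] [NeZero N] in
/-- **E-es-67 ⟸ E-es-67♯ ALONE (PROVED reduction).**  es's `PlusIndexPrimeToThreeOfNoRationalThreeTorsion` (lattice-optimal `W`,
`9 ∣ N`, no rational `3`-torsion on `E_{W,c}` ⟹ plus index prime to `3`) follows from its `μ₃`-half E-es-67♯
`PlusIndexPrimeToThreeOfMuThreeNoRationalThreeTorsion`; the other half E-es-67♮ is replaced by the theorem above (the leaf's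
`plusIndexPrimeToThreeOfNoRationalThreeTorsion_of_halves` needed both). [cite: Katz1980, Thm. 2 (m = ℓ)] -/
theorem plusIndexPrimeToThreeOfNoRationalThreeTorsion_of_sharp (h67s : PlusIndexPrimeToThreeOfMuThreeNoRationalThreeTorsion) :
    PlusIndexPrimeToThreeOfNoRationalThreeTorsion := by
  intro W _ _ N _ D hopt h9 hT
  by_cases hμ : HasShortMuThree W D.c
  · exact h67s W D hopt h9 hμ hT
  · exact plusIndexPrimeTo_three_of_no_shortThreeTorsion_of_not_hasShortMuThree W D.isNewformOf
      D.maninConstant_ne_zero_holds hT hμ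

omit W [W.IsElliptic] [W.IsGloballyMinimal] [NeZero N] in
/-- **E-an-128 ⟸ its `μ₃`-form (PROVED reduction).**  an's cusp-lifting law `ShimuraThreeForcesRationalThreeTorsion` follows from the
single residual statement «a lattice-optimal `W` with `μ₃ ⊂ W` (`HasShortMuThree W c`) and NO rational `3`-torsion on `E_{W,c}` has
`3 ∤ [Λ₀(f) : Λ₁(f)]`» — stated inline (no new definition). [cite: Katz1980, Thm. 2 (m = ℓ)] [cite: Vatsal2005, Rem. 1.18 (shape)] -/
theorem shimuraThreeForcesRationalThreeTorsion_of_muThree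
    (hres : ∀ (W : WeierstrassCurve ℚ) [W.IsElliptic] [W.IsGloballyMinimal] {N : ℕ} [NeZero N]
      (D : ModularParametrizationData W N),
      (∀ z ∈ D.L.lattice, ∃ w ∈ periodLattice D.f, z = D.c * w) →
      HasShortMuThree W D.c → (∀ X₀ Y₀ : ℚ, ¬ IsShortThreeTorsion W D.c X₀ Y₀) → ShimuraIndexPrimeTo 3 D.f) :
    ShimuraThreeForcesRationalThreeTorsion := by
  intro W _ _ N _ D hopt hS
  by_contra hT
  push Not at hT
  rcases exists_isShortThreeTorsion_or_hasShortMuThree_of_not_shimuraIndexPrimeTo_three W D.isNewformOf hS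
      D.maninConstant_ne_zero_holds with ⟨X₀, Y₀, h⟩ | hμ
  · exact hT X₀ Y₀ h
  · exact hS (hres W D hopt hμ hT)

end Summit.BirchSwinnertonDyer.BirchSwinnertonDyer.Theorems.ManinLocalTwoThree

end
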